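import Mathlib.Data.Matrix.Basic
import Mathlib.Algebra.Order.BigOperators.Ring.Finset
import Mathlib.Analysis.Real.Sqrt
import Mathlib.Data.Fintype.BigOperators
import Mathlib.Tactic.Linarith
import Mathlib.Tactic.Ring
import HarnessLib

/-!
# Kunisky–Yu §3.5/§4: elementary norm bounds from `S² = qI − J`

The graph-matrix norm bounds of Kunisky–Yu 2022 (arXiv:2211.02713, Propositions 3.21–3.27, 3.29,
3.31–3.34 and §4.2–§4.6), in the quadratic-form language of this formalisation and proved from the
conference-matrix identity `S² = qI − J` (`S` symmetric, `|S_{xy}| ≤ 1`) by Cauchy–Schwarz alone —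
no eigenvalues, no trace power method. With `N₂ = Σ Vm²`, `q = |V|`:

* `sum_sq_seidel_apply` — `Σ_a (Su)_a² = q Σ u² − (Σu)²`; `frob_sq_seidel_mul_le` —
  `‖SX‖_F² ≤ q‖X‖_F²`.
* `abs_seidel_quad_le` — `|uᵀSu| ≤ √q ‖u‖²` (KY: `‖S‖ = √q`, Proposition 2.5).
* `abs_sandwich_le` — `|Σ_{a,b,d} Vm_{ab}S_{bd}Vm_{da}| ≤ √q N₂` (`T^{3,1,1}`, Proposition 3.22).
* `sum_sq_diag_SVS_le` — `Σ_a (SVmS)_{aa}² ≤ q² N₂` (the vector `ℓ`; `T^{4,2,1/2}` on `V₂`,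
  Prop. 3.26).
* `abs_trVSVS_le` — `|tr(VmSVmS)| ≤ q N₂` (`T^{4,2,3}`, Proposition 3.27).
* `abs_rho_le` — `|Σ_{a,c} S_{ac}(VmS)_{ac}(SVm)_{ac}| ≤ q N₂` (`T^{4,3,1}`, Proposition 3.25).
* `sum_sq_SV_diag_le` — `Σ_a (Σ_c S_{ac}Vm_{ca})² ≤ q N₂`; `sq_sum_SV_le` —
  `(Σ_{a,c} S_{ac}Vm_{ca})² ≤ q² N₂`.

## References

* [KuniskyYu2022] D. Kunisky, X. Yu, arXiv:2211.02713, Props. 2.5, 3.21–3.27, §4.2–§4.6.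
-/

noncomputable section

namespace Literature.Combinatorics.SimpleGraph

open Matrix Finset

section Toolkit

variable {V : Type*} [Fintype V] [DecidableEq V] {S : Matrix V V ℝ}

/-- **`Σ_a (Su)_a² = q Σ_a u_a² − (Σ_a u_a)²`** for a symmetric `S` with `S² = qI − J`
(KY Proposition 4.6 (74)). [cite: KuniskyYu2022, Proposition 4.6 (74)] -/
theorem sum_sq_seidel_apply (hSs : ∀ x y, S x y = S y x)
    (hsq : S * S = (Fintype.card V : ℝ) • (1 : Matrix V V ℝ) - of fun _ _ => 1) (u : V → ℝ) :
    ∑ a, (∑ b, S a b * u b) ^ 2 = (Fintype.card V : ℝ) * ∑ a, u a ^ 2 - (∑ a, u a) ^ 2 := by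
  have h1 : ∑ a, (∑ b, S a b * u b) ^ 2 = ∑ b, ∑ c, u b * u c * (S * S) b c := by
    calc ∑ a, (∑ b, S a b * u b) ^ 2 = ∑ a, ∑ b, ∑ c, S a b * u b * (S a c * u c) := by
          refine Finset.sum_congr rfl fun a _ => ?_
          rw [sq, Finset.sum_mul_sum]
      _ = ∑ b, ∑ c, ∑ a, S a b * u b * (S a c * u c) := by
          rw [Finset.sum_comm]
          exact Finset.sum_congr rfl fun b _ => Finset.sum_comm
      _ = ∑ b, ∑ c, u b * u c * (S * S) b c := by
          refine Finset.sum_congr rfl fun b _ => Finset.sum_congr rfl fun c _ => ?_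
          rw [mul_apply, Finset.mul_sum]
          exact Finset.sum_congr rfl fun a _ => by rw [hSs a b]; ring
  rw [h1, hsq]
  have e : ∀ b c, u b * u c *
      ((((Fintype.card V : ℝ) • (1 : Matrix V V ℝ) - of fun _ _ => (1 : ℝ)) : Matrix V V ℝ) b c) =
        (if b = c then (Fintype.card V : ℝ) * (u b * u c) else 0) - u b * u c := by
    intro b c
    simp only [Matrix.sub_apply, Matrix.smul_apply, one_apply, of_apply, smul_eq_mul]
    split_ifs <;> ring
  simp only [e, Finset.sum_sub_distrib, Finset.sum_ite_eq, Finset.mem_univ, if_true]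
  rw [sq (∑ a, u a), Finset.sum_mul_sum, Finset.mul_sum]
  congr 1
  exact Finset.sum_congr rfl fun b _ => by ring

/-- **`‖SX‖_F² ≤ q ‖X‖_F²`**: `Σ_{a,c} (Σ_b S_{ab}X_{bc})² ≤ q Σ_{b,c} X_{bc}²` (column by column
from
`sum_sq_seidel_apply`; KY: `‖S‖ = √q`). [cite: KuniskyYu2022, Proposition 2.5] -/
theorem frob_sq_seidel_mul_le (hSs : ∀ x y, S x y = S y x)
    (hsq : S * S = (Fintype.card V : ℝ) • (1 : Matrix V V ℝ) - of fun _ _ => 1) (X : Matrix V V ℝ) :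
    ∑ a, ∑ c, (∑ b, S a b * X b c) ^ 2 ≤ (Fintype.card V : ℝ) * ∑ b, ∑ c, X b c ^ 2 := by
  have hL : ∑ a, ∑ c, (∑ b, S a b * X b c) ^ 2 = ∑ c, ∑ a, (∑ b, S a b * X b c) ^ 2 :=
    Finset.sum_comm
  have hR : (Fintype.card V : ℝ) * ∑ b, ∑ c, X b c ^ 2 =
      ∑ c, (Fintype.card V : ℝ) * ∑ b, X b c ^ 2 := by
    rw [show ∑ b, ∑ c, X b c ^ 2 = ∑ c, ∑ b, X b c ^ 2 from Finset.sum_comm, Finset.mul_sum]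
  rw [hL, hR]
  refine Finset.sum_le_sum fun c _ => ?_
  rw [sum_sq_seidel_apply hSs hsq (fun b => X b c)]
  nlinarith [sq_nonneg (∑ a, X a c)]

/-- **`|uᵀSu| ≤ √q ‖u‖²`** (the eigenvalue-free form of `‖S‖ = √q`, KY Proposition 2.5):
Cauchy–Schwarz
and `‖Su‖² ≤ q‖u‖²`. [cite: KuniskyYu2022, Proposition 2.5] -/
theorem abs_seidel_quad_le (hSs : ∀ x y, S x y = S y x)
    (hsq : S * S = (Fintype.card V : ℝ) • (1 : Matrix V V ℝ) - of fun _ _ => 1) (u : V → ℝ) :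
    |∑ a, ∑ b, u a * S a b * u b| ≤ Real.sqrt (Fintype.card V) * ∑ a, u a ^ 2 := by
  set q : ℝ := (Fintype.card V : ℝ) with hq
  have hform : ∑ a, ∑ b, u a * S a b * u b = ∑ a, u a * (∑ b, S a b * u b) := by
    refine Finset.sum_congr rfl fun a _ => ?_
    rw [Finset.mul_sum]
    exact Finset.sum_congr rfl fun b _ => by ring
  have hcs : (∑ a, u a * (∑ b, S a b * u b)) ^ 2 ≤ (∑ a, u a ^ 2) * ∑ a, (∑ b, S a b * u b) ^ 2 :=
    Finset.sum_mul_sq_le_sq_mul_sq _ _ _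
  have hSu : ∑ a, (∑ b, S a b * u b) ^ 2 ≤ q * ∑ a, u a ^ 2 := by
    rw [sum_sq_seidel_apply hSs hsq u]
    nlinarith [sq_nonneg (∑ a, u a)]
  set X : ℝ := ∑ a, u a * ∑ b, S a b * u b with hX
  set N : ℝ := ∑ a, u a ^ 2 with hN
  have hN0 : 0 ≤ N := Finset.sum_nonneg fun a _ => sq_nonneg _
  have hq0 : 0 ≤ q := Nat.cast_nonneg _
  have hX2 : X ^ 2 ≤ (Real.sqrt q * N) ^ 2 := by
    rw [mul_pow, Real.sq_sqrt hq0]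
    calc X ^ 2 ≤ N * ∑ a, (∑ b, S a b * u b) ^ 2 := hcs
      _ ≤ N * (q * N) := mul_le_mul_of_nonneg_left hSu hN0
      _ = q * N ^ 2 := by ring
  rw [hform]
  exact abs_le_of_sq_le_sq' hX2 (mul_nonneg (Real.sqrt_nonneg _) hN0) |> fun h => abs_le.2 h

/-- **The `T^{3,1,1}` bound**: `|Σ_{a,b,d} Vm_{ab}S_{bd}Vm_{da}| ≤ √q Σ Vm²` for `Vm` symmetric (row
by
row from `abs_seidel_quad_le`; KY Proposition 3.22, `‖T^{3,1,1}‖ = O(√p)`).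
[cite: KuniskyYu2022, Proposition 3.22] -/
theorem abs_sandwich_le (hSs : ∀ x y, S x y = S y x)
    (hsq : S * S = (Fintype.card V : ℝ) • (1 : Matrix V V ℝ) - of fun _ _ => 1)
    (Vm : Matrix V V ℝ) (hVs : ∀ x y, Vm x y = Vm y x) :
    |∑ a, ∑ b, ∑ d, Vm a b * S b d * Vm d a| ≤
      Real.sqrt (Fintype.card V) * ∑ a, ∑ b, Vm a b ^ 2 := by
  rw [Finset.mul_sum]
  refine (Finset.abs_sum_le_sum_abs _ _).trans (Finset.sum_le_sum fun a _ => ?_)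
  have h := abs_seidel_quad_le hSs hsq (fun b => Vm a b)
  have e : ∑ b, ∑ d, Vm a b * S b d * Vm d a = ∑ b, ∑ d, Vm a b * S b d * Vm a d :=
    Finset.sum_congr rfl fun b _ => Finset.sum_congr rfl fun d _ => by rw [hVs d a]
  rw [e]
  exact h

omit [DecidableEq V] in
/-- Diagonal entries are dominated by the Frobenius norm: `Σ_a M_{aa}² ≤ Σ_{a,e} M_{ae}²`.
[folklore] -/
theorem sum_sq_diag_le_frob (M : Matrix V V ℝ) : ∑ a, M a a ^ 2 ≤ ∑ a, ∑ e, M a e ^ 2 :=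
  Finset.sum_le_sum fun a _ =>
    Finset.single_le_sum (f := fun e => M a e ^ 2) (fun _ _ => sq_nonneg _) (Finset.mem_univ a)

/-- **The vector `ℓ_a = (SVmS)_{aa}` is small**: `Σ_a (Σ_{c,d} S_{ac}Vm_{cd}S_{da})² ≤ q² Σ Vm²` for
`S, Vm`
symmetric with `S² = qI − J` (`‖ℓ‖ ≤ ‖SVmS‖_F ≤ √q‖VmS‖_F ≤ q‖Vm‖_F`; the `V₂`-refined bounds of
KY Proposition 3.26). [cite: KuniskyYu2022, Proposition 3.26] -/
theorem sum_sq_diag_SVS_le (hSs : ∀ x y, S x y = S y x)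
    (hsq : S * S = (Fintype.card V : ℝ) • (1 : Matrix V V ℝ) - of fun _ _ => 1)
    (Vm : Matrix V V ℝ) (hVs : ∀ x y, Vm x y = Vm y x) :
    ∑ a, (∑ c, ∑ d, S a c * Vm c d * S d a) ^ 2 ≤
      (Fintype.card V : ℝ) ^ 2 * ∑ a, ∑ b, Vm a b ^ 2 := by
  set q : ℝ := (Fintype.card V : ℝ) with hq
  have hq0 : 0 ≤ q := Nat.cast_nonneg _
  -- `X = Vm S`, `ℓ_a = (S X)_{aa}`
  set X : Matrix V V ℝ := Vm * S with hX
  have hl : ∀ a, ∑ c, ∑ d, S a c * Vm c d * S d a = ∑ c, S a c * X c a := by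
    intro a
    refine Finset.sum_congr rfl fun c _ => ?_
    rw [hX, mul_apply, Finset.mul_sum]
    exact Finset.sum_congr rfl fun d _ => by ring
  simp only [hl]
  -- diagonal ≤ Frobenius of `S X`
  have h1 : ∑ a, (∑ c, S a c * X c a) ^ 2 ≤ ∑ a, ∑ e, (∑ c, S a c * X c e) ^ 2 :=
    sum_sq_diag_le_frob (Matrix.of fun a e => ∑ c, S a c * X c e)
  -- `‖SX‖² ≤ q ‖X‖²`
  have h2 : ∑ a, ∑ e, (∑ c, S a c * X c e) ^ 2 ≤ q * ∑ c, ∑ e, X c e ^ 2 :=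
    frob_sq_seidel_mul_le hSs hsq X
  -- `‖X‖² = ‖Vm S‖² = ‖S Vm‖²` and `‖S Vm‖² ≤ q ‖Vm‖²`
  have h3 : ∑ c, ∑ e, X c e ^ 2 = ∑ e, ∑ c, (∑ b, S e b * Vm b c) ^ 2 := by
    rw [Finset.sum_comm]
    refine Finset.sum_congr rfl fun e _ => Finset.sum_congr rfl fun c _ => ?_
    rw [hX, mul_apply]
    congr 1
    exact Finset.sum_congr rfl fun b _ => by rw [hSs b e, hVs c b, mul_comm]
  have h4 : ∑ e, ∑ c, (∑ b, S e b * Vm b c) ^ 2 ≤ q * ∑ b, ∑ c, Vm b c ^ 2 :=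
    frob_sq_seidel_mul_le hSs hsq Vm
  calc ∑ a, (∑ c, S a c * X c a) ^ 2 ≤ q * ∑ c, ∑ e, X c e ^ 2 := h1.trans h2
    _ = q * ∑ e, ∑ c, (∑ b, S e b * Vm b c) ^ 2 := by rw [h3]
    _ ≤ q * (q * ∑ b, ∑ c, Vm b c ^ 2) := mul_le_mul_of_nonneg_left h4 hq0
    _ = q ^ 2 * ∑ a, ∑ b, Vm a b ^ 2 := by ring

/-- `‖Vm S‖_F² ≤ q ‖Vm‖_F²` for `S, Vm` symmetric with `S² = qI − J`:
`Σ_{a,c} (Σ_b Vm_{ab}S_{bc})² ≤ q Σ Vm²`. [cite: KuniskyYu2022, Proposition 2.5] -/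
theorem frob_sq_mul_seidel_le (hSs : ∀ x y, S x y = S y x)
    (hsq : S * S = (Fintype.card V : ℝ) • (1 : Matrix V V ℝ) - of fun _ _ => 1)
    (Vm : Matrix V V ℝ) (hVs : ∀ x y, Vm x y = Vm y x) :
    ∑ a, ∑ c, (∑ b, Vm a b * S b c) ^ 2 ≤ (Fintype.card V : ℝ) * ∑ a, ∑ b, Vm a b ^ 2 := by
  have h : ∑ a, ∑ c, (∑ b, Vm a b * S b c) ^ 2 = ∑ c, ∑ a, (∑ b, S c b * Vm b a) ^ 2 := by
    rw [Finset.sum_comm]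
    refine Finset.sum_congr rfl fun c _ => Finset.sum_congr rfl fun a _ => ?_
    congr 1
    exact Finset.sum_congr rfl fun b _ => by rw [hSs c b, hVs a b, mul_comm]
  rw [h]
  have h2 := frob_sq_seidel_mul_le hSs hsq Vm
  calc ∑ c, ∑ a, (∑ b, S c b * Vm b a) ^ 2 ≤ (Fintype.card V : ℝ) * ∑ b, ∑ c, Vm b c ^ 2 := h2
    _ = (Fintype.card V : ℝ) * ∑ a, ∑ b, Vm a b ^ 2 := rfl

/-- **The `T^{4,2,3}` bound**: `|tr(VmSVmS)| = |Σ_{a,c}(VmS)_{ac}(VmS)_{ca}| ≤ ‖VmS‖_F² ≤ q Σ Vm²`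
(KY Proposition 3.27). [cite: KuniskyYu2022, Proposition 3.27] -/
theorem abs_trVSVS_le (hSs : ∀ x y, S x y = S y x)
    (hsq : S * S = (Fintype.card V : ℝ) • (1 : Matrix V V ℝ) - of fun _ _ => 1)
    (Vm : Matrix V V ℝ) (hVs : ∀ x y, Vm x y = Vm y x) :
    |∑ a, ∑ b, ∑ c, ∑ d, Vm a b * S b c * Vm c d * S d a| ≤
      (Fintype.card V : ℝ) * ∑ a, ∑ b, Vm a b ^ 2 := by
  set X : Matrix V V ℝ := Vm * S with hX
  have hform : ∑ a, ∑ b, ∑ c, ∑ d, Vm a b * S b c * Vm c d * S d a = ∑ a, ∑ c, X a c * X c a := by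
    refine Finset.sum_congr rfl fun a _ => ?_
    rw [Finset.sum_comm]
    refine Finset.sum_congr rfl fun c _ => ?_
    rw [hX, mul_apply, mul_apply, Finset.sum_mul_sum]
    exact Finset.sum_congr rfl fun b _ => Finset.sum_congr rfl fun d _ => by ring
  have hF : ∑ a, ∑ c, X a c ^ 2 ≤ (Fintype.card V : ℝ) * ∑ a, ∑ b, Vm a b ^ 2 := by
    have h := frob_sq_mul_seidel_le hSs hsq Vm hVs
    simp only [hX, mul_apply] at h ⊢
    exact h
  rw [hform, abs_le]
  constructor
  · -- `-‖X‖² ≤ Σ X_ac X_ca` from `(X_ac + X_ca)² ≥ 0`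
    have h : ∑ a, ∑ c, X a c * X c a ≥ -(∑ a, ∑ c, X a c ^ 2) := by
      have h2 : ∑ a, ∑ c, (X a c ^ 2 + X c a ^ 2 + 2 * (X a c * X c a)) ≥ 0 :=
        Finset.sum_nonneg fun a _ => Finset.sum_nonneg fun c _ => by
          nlinarith [sq_nonneg (X a c + X c a)]
      have hsym : ∑ a, ∑ c, X c a ^ 2 = ∑ a, ∑ c, X a c ^ 2 := Finset.sum_comm
      simp only [Finset.sum_add_distrib, ← Finset.mul_sum] at h2
      linarith
    linarith
  · have h : ∑ a, ∑ c, X a c * X c a ≤ ∑ a, ∑ c, X a c ^ 2 := by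
      have h2 : ∑ a, ∑ c, (X a c ^ 2 + X c a ^ 2 - 2 * (X a c * X c a)) ≥ 0 :=
        Finset.sum_nonneg fun a _ => Finset.sum_nonneg fun c _ => by
          nlinarith [sq_nonneg (X a c - X c a)]
      have hsym : ∑ a, ∑ c, X c a ^ 2 = ∑ a, ∑ c, X a c ^ 2 := Finset.sum_comm
      simp only [Finset.sum_add_distrib, Finset.sum_sub_distrib, ← Finset.mul_sum] at h2
      linarith
    linarith

/-- **The `T^{4,3,1}` bound**:
`|Σ_{a,c} S_{ac}(VmS)_{ac}(SVm)_{ac}| ≤ ½(‖VmS‖_F² + ‖SVm‖_F²) ≤ q Σ Vm²` for `|S| ≤ 1`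
(KY Proposition 3.25, there by the trace power method). [cite: KuniskyYu2022, Proposition 3.25] -/
theorem abs_rho_le (hSs : ∀ x y, S x y = S y x) (hSb : ∀ x y, |S x y| ≤ 1)
    (hsq : S * S = (Fintype.card V : ℝ) • (1 : Matrix V V ℝ) - of fun _ _ => 1)
    (Vm : Matrix V V ℝ) (hVs : ∀ x y, Vm x y = Vm y x) :
    |∑ a, ∑ c, S a c * (∑ b, Vm a b * S b c) * (∑ d, S a d * Vm d c)| ≤
      (Fintype.card V : ℝ) * ∑ a, ∑ b, Vm a b ^ 2 := by
  have hX := frob_sq_mul_seidel_le hSs hsq Vm hVs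
  have hY := frob_sq_seidel_mul_le hSs hsq Vm
  have hpt : ∀ a c, 2 * |S a c * (∑ b, Vm a b * S b c) * (∑ d, S a d * Vm d c)| ≤
      (∑ b, Vm a b * S b c) ^ 2 + (∑ d, S a d * Vm d c) ^ 2 := by
    intro a c
    rw [abs_mul, abs_mul]
    have h1 : |S a c| * |∑ b, Vm a b * S b c| ≤ |∑ b, Vm a b * S b c| :=
      (mul_le_of_le_one_left (abs_nonneg _) (hSb a c))
    have h2 : |S a c| * |∑ b, Vm a b * S b c| * |∑ d, S a d * Vm d c| ≤
        |∑ b, Vm a b * S b c| * |∑ d, S a d * Vm d c| :=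
      mul_le_mul_of_nonneg_right h1 (abs_nonneg _)
    rw [← sq_abs (∑ b, Vm a b * S b c), ← sq_abs (∑ d, S a d * Vm d c)]
    nlinarith [sq_nonneg (|∑ b, Vm a b * S b c| - |∑ d, S a d * Vm d c|)]
  have habs : |∑ a, ∑ c, S a c * (∑ b, Vm a b * S b c) * (∑ d, S a d * Vm d c)| ≤
      ∑ a, ∑ c, |S a c * (∑ b, Vm a b * S b c) * (∑ d, S a d * Vm d c)| :=
    (Finset.abs_sum_le_sum_abs _ _).trans
      (Finset.sum_le_sum fun a _ => Finset.abs_sum_le_sum_abs _ _)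
  have hsum : 2 * ∑ a, ∑ c, |S a c * (∑ b, Vm a b * S b c) * (∑ d, S a d * Vm d c)| ≤
      ∑ a, ∑ c, ((∑ b, Vm a b * S b c) ^ 2 + (∑ d, S a d * Vm d c) ^ 2) := by
    rw [Finset.mul_sum]
    refine Finset.sum_le_sum fun a _ => ?_
    rw [Finset.mul_sum]
    exact Finset.sum_le_sum fun c _ => hpt a c
  simp only [Finset.sum_add_distrib] at hsum
  have hY' : ∑ a, ∑ c, (∑ d, S a d * Vm d c) ^ 2 ≤ (Fintype.card V : ℝ) * ∑ a, ∑ b, Vm a b ^ 2 := hY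
  linarith

omit [DecidableEq V] in
/-- **`Σ_a (Σ_c S_{ac}Vm_{ca})² ≤ q Σ Vm²`** for `|S| ≤ 1` (the vector `h`; Cauchy–Schwarz row by
row).
[folklore] -/
theorem sum_sq_SV_diag_le (hSb : ∀ x y, |S x y| ≤ 1) (Vm : Matrix V V ℝ) :
    ∑ a, (∑ c, S a c * Vm c a) ^ 2 ≤ (Fintype.card V : ℝ) * ∑ a, ∑ b, Vm a b ^ 2 := by
  rw [show ∑ a, ∑ b, Vm a b ^ 2 = ∑ a, ∑ c, Vm c a ^ 2 from Finset.sum_comm, Finset.mul_sum]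
  refine Finset.sum_le_sum fun a _ => ?_
  have hcs := Finset.sum_mul_sq_le_sq_mul_sq (univ : Finset V) (fun c => S a c) (fun c => Vm c a)
  have hS2 : ∑ c, S a c ^ 2 ≤ Fintype.card V := by
    calc ∑ c, S a c ^ 2 ≤ ∑ _c : V, (1 : ℝ) := Finset.sum_le_sum fun c _ => by
            have h := hSb a c
            rw [← sq_abs]; nlinarith [abs_nonneg (S a c)]
      _ = Fintype.card V := by simp
  have hN : 0 ≤ ∑ c, Vm c a ^ 2 := Finset.sum_nonneg fun c _ => sq_nonneg _
  calc (∑ c, S a c * Vm c a) ^ 2 ≤ (∑ c, S a c ^ 2) * ∑ c, Vm c a ^ 2 := hcs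
    _ ≤ Fintype.card V * ∑ c, Vm c a ^ 2 := mul_le_mul_of_nonneg_right hS2 hN

omit [DecidableEq V] in
/-- **`(Σ_{a,c} S_{ac}Vm_{ca})² ≤ q² Σ Vm²`** for `|S| ≤ 1` (the scalar `τ = ⟨S, Vm⟩_F`;
Cauchy–Schwarz on `V × V`). [folklore] -/
theorem sq_sum_SV_le (hSb : ∀ x y, |S x y| ≤ 1) (Vm : Matrix V V ℝ) :
    (∑ a, ∑ c, S a c * Vm c a) ^ 2 ≤ (Fintype.card V : ℝ) ^ 2 * ∑ a, ∑ b, Vm a b ^ 2 := by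
  have h1 : (∑ a, ∑ c, S a c * Vm c a) ^ 2 ≤ Fintype.card V * ∑ a, (∑ c, S a c * Vm c a) ^ 2 := by
    have hcs := Finset.sum_mul_sq_le_sq_mul_sq (univ : Finset V) (fun _ => (1 : ℝ))
      (fun a => ∑ c, S a c * Vm c a)
    simp only [one_mul, one_pow, sum_const, card_univ, nsmul_eq_mul, mul_one] at hcs
    exact hcs
  have h2 := sum_sq_SV_diag_le hSb Vm
  have hq : (0 : ℝ) ≤ Fintype.card V := Nat.cast_nonneg _
  calc (∑ a, ∑ c, S a c * Vm c a) ^ 2 ≤ Fintype.card V * ∑ a, (∑ c, S a c * Vm c a) ^ 2 := h1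
    _ ≤ Fintype.card V * ((Fintype.card V : ℝ) * ∑ a, ∑ b, Vm a b ^ 2) :=
        mul_le_mul_of_nonneg_left h2 hq
    _ = (Fintype.card V : ℝ) ^ 2 * ∑ a, ∑ b, Vm a b ^ 2 := by ring

end Toolkit

end Literature.Combinatorics.SimpleGraph

end
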